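import Summits.ResolutionOfSingularities.ResolutionOfSingularities.Theorems.ToricLadderKernels
import Summits.ResolutionOfSingularities.ResolutionOfSingularities.Theorems.ValuativeLuAlphaPTorsorKnownRanges
import HarnessLib

/-!
# ToricLadderLinks — decomp-res node «ToricLadder» (lens-1 g14 ArchimedeanLadder → g15 DensityLadder → g16
ToricLadder), tree file 3/5

Content VERBATIM from the decomp-res lens-1 g16 file `HOME/decomp-res-lens-1/g16/ToricLadder.lean` (sha256
67376591e05ef26e…; PARTS I–II =
g15 `DensityLadder.lean` @6c32844d l.120–1091 = g14 `ArchimedeanLadder.lean` PART I, all carried verbatim by the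
lens), namespace renamed
`…Theses.ToricLadder` ↦ `…Theorems.ToricLadder` (ONE namespace for all five tree files so the lens's
dot-notation and unqualified references
stay verbatim), `set_option` lines dropped.  HOME = run/shared/lean/pub/decomp-res.  Landed by decomp-res writer g6
as SUPPORT of the
Valuative route item 0641 `LuAlphaPTorsor` (critic rows 113/116 + order 2026-08-30T17:45:44Z: g16 supersedes g15 for
landing; lens-1 WRITER.md);
no Valuative route edit is made by the decomp-res cell (the located residual `NonToricArchLU 2 4` and the port
`ToricAscent 2` stay tree
definitions here, documented, for the Valuative tenure / operator to book).  Two elementary lemmas that restate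
landed declarations are
deleted and cited BY NAME instead (gate dedup, p782367): `mem_of_mem_nonunits_of_le` (≡
`WildSymbol.Birth.nonunits_subset_of_le`, whose module is not importable here) ↦ its one-line Mathlib proof
inlined at the single use, `algebraMap_mem_of_le` ↦
`Literature.AlgebraicGeometry.Resolution.algebraMap_mem_of_le`.

PART I §7 links to the host 0641 `Valuative.LuAlphaPTorsor`, the route thesis `LUrel` and the root BY NAME; PART II §8 the
DENSITY LAW one rung down (Knaf–Kuhlmann 2009 Prop. 3.11 over the previous rung) — PROVED.
(Sources: CossartPiltant2019; KnafKuhlmann2005 arXiv:math/0304159 Thm 4.1 + §4 remarks (1)–(3); KnafKuhlmann2009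
arXiv:math/0702856 Prop 3.11, Thm 1.5; SanSaturnino2017 arXiv:1412.7697 Thm 7.5; NovacoskiSpivakovsky2014
arXiv:1204.4751; ZariskiSamuelII.)
-/

noncomputable section

open IsLocalRing Literature.AlgebraicGeometry.Resolution
open Summit.ResolutionOfSingularities.ResolutionOfSingularities.Theses
open Summit.ResolutionOfSingularities.ResolutionOfSingularities.Theorems
open Summit.ResolutionOfSingularities.ResolutionOfSingularities.Theorems.PfaffLine

namespace Summit.ResolutionOfSingularities.ResolutionOfSingularities.Theorems.ToricLadder

/-! ## 7. Links to the host, the route thesis and the root (BY NAME) -/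

section Links

variable {k K : Type} [Field k] [Field K] [Algebra k K]

/-- A finitely generated model with fraction field `K` bounds `tr.deg_k K`. [folklore] -/
theorem exists_nat_trdeg_le (R : Subalgebra k K) (hR : R.FG) [IsFractionRing R K] :
    ∃ d : ℕ, Algebra.trdeg k K ≤ d := by
  haveI : Algebra.FiniteType k R := R.fg_iff_finiteType.mp hR
  obtain ⟨n, -, htr⟩ := exists_ringKrullDim_eq_and_trdeg_eq k R
  exact ⟨n, by rw [trdeg_eq_trdeg_of_isFractionRing R, htr]⟩

/-- Enlarging a finitely generated `R ⊆ O` to a model of `K` inside `O` (affine model of `O`). [folklore] -/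
theorem exists_fg_isFractionRing_between' (hKfg : (⊤ : IntermediateField k K).FG)
    (O : ValuationSubring K) (hkO : ∀ c : k, algebraMap k K c ∈ O) (R : Subalgebra k K)
    (hRfg : R.FG) (hRO : R.toSubring ≤ O.toSubring) :
    ∃ R' : Subalgebra k K, R ≤ R' ∧ R'.FG ∧ R'.toSubring ≤ O.toSubring ∧ IsFractionRing R' K := by
  obtain ⟨A₀, hA₀O, hA₀fg, hA₀fr⟩ := exists_affineModel k K hKfg O hkO
  let Oalg : Subalgebra k K := { O.toSubring with algebraMap_mem' := hkO }
  have hRle : R ≤ Oalg := fun x hx => hRO hx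
  have hA₀le : A₀ ≤ Oalg := fun x hx => hA₀O hx
  have hle : R ⊔ A₀ ≤ Oalg := sup_le hRle hA₀le
  haveI := hA₀fr
  exact ⟨R ⊔ A₀, le_sup_left, hRfg.sup hA₀fg, fun x hx => hle hx,
    isFractionRing_subalgebra_of_le A₀ (R ⊔ A₀) le_sup_right⟩

end Links

/-- **The ladder's union is the route THESIS `LUrel`** (EQUIV layer, costume-free bookkeeping:
`LURel d` is the filtration of `LUrel` by transcendence degree). [folklore] -/
theorem lurelP_of_luRel (h : ∀ d, LURel d) (p : ℕ) (hp : p.Prime) : LurelP p := by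
  intro k K _ _ _ _ hKfg O hkO R hRfg hRO
  obtain ⟨R', hRR', hR'fg, hR'O, hR'fr⟩ := exists_fg_isFractionRing_between' hKfg O hkO R hRfg hRO
  haveI := hR'fr
  obtain ⟨d, hd⟩ := exists_nat_trdeg_le R' hR'fg
  obtain ⟨A, hA, hle, hAfg, hreg⟩ := h d p hp k K hd O R' hR'fg hR'fr hR'O
  exact ⟨A, hA, hRR'.trans hle, hAfg, isFractionRing_subalgebra_of_le R' A hle, hreg⟩

/-- `luRel_of_lurelP`: Auxiliary step of this node's calculus, VERBATIM from the lens file (see the module docstring); the statement is its type. [folklore] -/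
theorem luRel_of_lurelP (h : ∀ p, p.Prime → LurelP p) (d : ℕ) : LURel d := by
  intro p hp k K _ _ _ _ hd O R hRfg hfrac hRO
  haveI := hfrac
  obtain ⟨A, hA, hle, hAfg, -, hreg⟩ :=
    h p hp k K (PfaffLine.intermediateField_top_fg_of_isFractionRing R hRfg) O (algebraMap_mem_of_le O R hRO) R hRfg hRO
  exact ⟨A, hA, hle, hAfg, hreg⟩

/-- `luRel_iff_lurelP`: Auxiliary step of this node's calculus, VERBATIM from the lens file (see the module docstring); the statement is its type. [folklore] -/
theorem luRel_iff_lurelP : (∀ d, LURel d) ↔ ∀ p, p.Prime → LurelP p :=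
  ⟨lurelP_of_luRel, luRel_of_lurelP⟩

/-- `LurelP p` is, definitionally, the hypothesis of `Valuative.PatchingRel` at `p` … [folklore] -/
theorem resolutionInChar_of_lurelP (h₃ : Valuative.PatchingRel) (p : ℕ) (hp : p.Prime)
    (h : LurelP p) : ResolutionInChar.{0} p :=
  h₃ p hp h

/-- … the conclusion of `Valuative.TorsorToLurel` at `p` … [folklore] -/
theorem lurelP_of_torsorToLurel (h₄ : Valuative.TorsorToLurel) (h₂ : Valuative.LuAlphaPTorsor)
    (p : ℕ) (hp : p.Prime) : LurelP p :=
  h₄ p hp (h₂ p hp)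

/-- … and the conclusion of the PROVED support item `Valuative.LurelOfResolution`
(`Theorems.lurelOfResolution_proof` = `lurel_of_resolutionInChar`). [folklore] -/
theorem lurelP_of_resolutionInChar (p : ℕ) (hp : p.Prime) (h : ResolutionInChar.{0} p) : LurelP p :=
  lurel_of_resolutionInChar p hp h

/-- **HOST BY NAME.** The full ladder gives the host crux `Valuative.LuAlphaPTorsor` (0641)
(for any `O`, apply the rung `tr.deg_k K` to the model `A₀[t] ⊆ O`; `t ∈ O` as `t ^ p ∈ A₀ ⊆ O`). [folklore] -/
theorem luAlphaPTorsor_of_luRel (h : ∀ d, LURel d) : Valuative.LuAlphaPTorsor := by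
  intro p hp k K _ _ _ _ O A₀ h₀ t hfg htp hfr hreg
  have htO : t ∈ O := mem_valuationSubring_of_pow_mem O hp.pos (h₀ htp)
  haveI := hfr
  obtain ⟨d, hd⟩ := exists_nat_trdeg_le (Algebra.adjoin k (insert t (A₀ : Set K)))
    (fg_adjoin_insert hfg t)
  exact exists_regularModel_of_relLocalUniformization O (h d p hp k K hd O) A₀ h₀ t hfg htO hfr

/-- **HOST BY NAME, located form.** Floor + archimedean cores ⇒ the host crux. [folklore] -/
theorem luAlphaPTorsor_of_archCore (hCP : CossartPiltant2019LU3.{0})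
    (hA : ∀ d, 4 ≤ d → ArchCoreLU d) : Valuative.LuAlphaPTorsor :=
  luAlphaPTorsor_of_luRel (luRel_of_archCore hCP hA)

/-- **ROOT BY NAME (deciding theorem of this node).** Floor (in print) + archimedean cores +
the route's patching crux `Valuative.PatchingRel` (0642) ⇒ `ResolutionOfSingularities`. [folklore] -/
theorem closes_arch (hCP : CossartPiltant2019LU3.{0}) (hA : ∀ d, 4 ≤ d → ArchCoreLU d)
    (h₃ : Valuative.PatchingRel) : _root_.ResolutionOfSingularities :=
  fun p hp => h₃ p hp (lurelP_of_luRel (luRel_of_archCore hCP hA) p hp)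

/-- The same through the route's own deciding theorem `Valuative.closes`. [folklore] -/
theorem closes_arch' (hCP : CossartPiltant2019LU3.{0}) (hA : ∀ d, 4 ≤ d → ArchCoreLU d)
    (h₄ : Valuative.TorsorToLurel) (h₃ : Valuative.PatchingRel) :
    _root_.ResolutionOfSingularities :=
  Valuative.closes (luAlphaPTorsor_of_archCore hCP hA) h₄ h₃

/-- **WEAKER (kernel): every rung, hence every piece, is a consequence of the ROOT**
(`lurel_of_resolutionInChar`, the proof of `Valuative.LurelOfResolution`). [folklore] -/
theorem luRel_of_root (hS : _root_.ResolutionOfSingularities) (d : ℕ) : LURel d :=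
  luRel_of_lurelP (fun p hp => lurelP_of_resolutionInChar p hp (hS p hp)) d

/-- `archCoreLU_of_root`: Auxiliary step of this node's calculus, VERBATIM from the lens file (see the module docstring); the statement is its type. [folklore] -/
theorem archCoreLU_of_root (hS : _root_.ResolutionOfSingularities) (d : ℕ) : ArchCoreLU d :=
  archCoreLU_of_luRel (luRel_of_root hS d)

/-- **WEAKER than the host's cone:** the host crux together with the route's (closed-mod-print,
Temkin 2013) transfer `TorsorToLurel` gives every piece. [folklore] -/
theorem luRel_of_hostCone (h₂ : Valuative.LuAlphaPTorsor) (h₄ : Valuative.TorsorToLurel) (d : ℕ) :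
    LURel d :=
  luRel_of_lurelP (fun p hp => lurelP_of_torsorToLurel h₄ h₂ p hp) d

/-- `archCoreLU_of_hostCone`: Auxiliary step of this node's calculus, VERBATIM from the lens file (see the module docstring); the statement is its type. [folklore] -/
theorem archCoreLU_of_hostCone (h₂ : Valuative.LuAlphaPTorsor) (h₄ : Valuative.TorsorToLurel)
    (d : ℕ) : ArchCoreLU d :=
  archCoreLU_of_luRel (luRel_of_hostCone h₂ h₄ d)

/-- Summary of the node (root-level): `ResolutionOfSingularities` is equivalent, modulo the
Cossart–Piltant floor and the route's patching crux, to the archimedean cores in transcendence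
degree `≥ 4`. [folklore] -/
theorem root_iff_archCore (hCP : CossartPiltant2019LU3.{0}) (h₃ : Valuative.PatchingRel) :
    _root_.ResolutionOfSingularities ↔ ∀ d, 4 ≤ d → ArchCoreLU d :=
  ⟨fun hS d _ => archCoreLU_of_root hS d, fun hA => closes_arch hCP hA h₃⟩

/-! # PART II — the density cut (gen 15)

## 8. Dense re-basing: relative local uniformization ascends separable dense extensions -/

section Dense

variable {k K : Type} [Field k] [Field K] [Algebra k K]

/-- `K` is DENSE over the intermediate field `F₀` for the valuation of `O`: every `x ∈ K` is
approximable from `F₀` to within every value `v w`, `w ≠ 0` ("`(K, v)` lies in the completion of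
`(F₀, v|F₀)`" — the hypothesis of Knaf–Kuhlmann 2009, Prop. 3.11 / Thm. 1.5, typed exactly as in the
tree's `PfaffLine.stub_stronglySmoothTopOverAbhyankarSubfield`). -/
def IsDenseOver (O : ValuationSubring K) (F₀ : IntermediateField k K) : Prop :=
  ∀ x w : K, w ≠ 0 → ∃ a ∈ F₀, O.valuation (x - a) < O.valuation w

variable (k) in
/-- The CELL DATUM at base rung `d`: a finitely generated intermediate field `F₀` of `K/k` with
`tr.deg_k F₀ ≤ d`, over which `K` is separably generated and dense. -/
def SepDenseBelow (O : ValuationSubring K) (d : ℕ) : Prop :=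
  ∃ F₀ : IntermediateField k K, F₀.FG ∧ Algebra.trdeg k F₀ ≤ d ∧
    SeparablyGeneratedOver F₀.toSubfield (⊤ : Subfield K) ∧ IsDenseOver O F₀

/-- **TRANSPORT (hypothesis (hB) of Knaf–Kuhlmann's Prop. 3.5 from relative LU of the subfield).**
If the valued subfield `(F₀, O ∩ F₀)` of `(K, O)` admits relative local uniformization over `k`, then
every finite `Z ⊆ O ∩ F₀` lies in a finitely generated `k`-subalgebra `B ⊆ O ∩ F₀` of `K` with
`Frac B = F₀` whose local ring at the centre of `O` is regular.  (The transport template of the tree's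
`PfaffLine.relLU_zeroDim_abhyankar_intermediateField`, with the Abhyankar theorem replaced by the
hypothesis: pull `Z` back to `F₀`, enlarge `k[Z]` to an affine model of `O ∩ F₀`
(`exists_fg_isFractionRing_between'`), uniformize, push the model forward along `F₀ → K`.) [folklore] -/
theorem regularBase_of_relLU (O : ValuationSubring K) (hk : ∀ c : k, algebraMap k K c ∈ O)
    (M : IntermediateField k K) (hMfg : M.FG)
    (hLU : RelLocalUniformization k M (O.comap (algebraMap M K))) (Z : Finset K)
    (hZ : ∀ z ∈ Z, z ∈ O ∧ z ∈ M.toSubfield) :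
    ∃ (B : Subalgebra k K) (hB : B.toSubring ≤ O.toSubring), (B : Set K) ⊆ M.toSubfield ∧
      (Z : Set K) ⊆ B ∧ B.FG ∧ (∀ x ∈ M.toSubfield, ∃ a ∈ B, ∃ b ∈ B, x = a / b) ∧
      IsRegularLocalRing (Localization.AtPrime
        (Ideal.comap (Subring.inclusion hB) (IsLocalRing.maximalIdeal O))) := by
  classical
  have hmemO' : ∀ z : M, z ∈ O.comap (algebraMap M K) ↔ (z : K) ∈ O := fun z =>
    ValuationSubring.mem_comap
  have hk' : ∀ c : k, algebraMap k M c ∈ O.comap (algebraMap M K) := fun c => by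
    rw [ValuationSubring.mem_comap, ← IsScalarTower.algebraMap_apply]
    exact hk c
  have hfgM : (⊤ : IntermediateField k M).FG :=
    IntermediateField.fg_top_iff.mpr (IntermediateField.essFiniteType_iff.mpr hMfg)
  -- the finite set, pulled back to `M`, and the subalgebra it generates
  let Z' : Finset M := Z.preimage (fun z : M => (z : K)) Subtype.val_injective.injOn
  have hZ' : ∀ z : M, z ∈ Z' ↔ (z : K) ∈ Z := fun z => Finset.mem_preimage
  let OM : Subalgebra k M :=
    { (O.comap (algebraMap M K)).toSubring with
      algebraMap_mem' := fun c => hk' c }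
  have hmemOM : ∀ z : M, z ∈ OM ↔ z ∈ O.comap (algebraMap M K) := fun z => Iff.rfl
  have hS'le : Algebra.adjoin k (Z' : Set M) ≤ OM := by
    refine Algebra.adjoin_le fun z hz => ?_
    rw [Finset.mem_coe, hZ'] at hz
    exact (hmemOM z).mpr ((hmemO' z).mpr (hZ _ hz).1)
  have hS'O : (Algebra.adjoin k (Z' : Set M)).toSubring ≤ (O.comap (algebraMap M K)).toSubring :=
    fun z hz => hS'le hz
  -- enlarge `k[Z']` to an affine model of `O ∩ M` and uniformize it
  obtain ⟨R', hS'R', hR'fg, hR'O, hR'fr⟩ := exists_fg_isFractionRing_between' hfgM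
    (O.comap (algebraMap M K)) hk' (Algebra.adjoin k (Z' : Set M)) (Subalgebra.fg_adjoin_finset Z')
    hS'O
  haveI := hR'fr
  obtain ⟨A, h, hR'A, hAfg, hreg⟩ := hLU R' hR'fg hR'fr hR'O
  have hfrac : IsFractionRing A M := isFractionRing_subalgebra_of_le R' A hR'A
  have hSA : Algebra.adjoin k (Z' : Set M) ≤ A := hS'R'.trans hR'A
  -- push the model forward into `K`
  let B : Subalgebra k K := A.map M.val
  have hmemB : ∀ z : K, z ∈ B ↔ ∃ a ∈ A, (a : K) = z := fun z => Subalgebra.mem_map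
  have hBO : B.toSubring ≤ O.toSubring := by
    intro z hz
    obtain ⟨a, ha, rfl⟩ := (hmemB z).mp hz
    exact (hmemO' a).mp (h ha)
  refine ⟨B, hBO, ?_, ?_, hAfg.map _, ?_, ?_⟩
  · -- `B ⊆ M`
    intro z hz
    obtain ⟨a, -, rfl⟩ := (hmemB z).mp hz
    exact a.2
  · -- `Z ⊆ B`
    intro z hz
    have hzM : z ∈ M := (IntermediateField.mem_toSubfield _ _).mp (hZ z hz).2
    refine (hmemB z).mpr ⟨⟨z, hzM⟩, hSA (Algebra.subset_adjoin ?_), rfl⟩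
    rw [Finset.mem_coe, hZ']
    exact hz
  · -- `Frac B = M`
    intro x hx
    have hxM : x ∈ M := (IntermediateField.mem_toSubfield _ _).mp hx
    obtain ⟨a, b, -, hab⟩ := IsFractionRing.div_surjective (A := A) (⟨x, hxM⟩ : M)
    refine ⟨((a : M) : K), (hmemB _).mpr ⟨a, a.2, rfl⟩, ((b : M) : K),
      (hmemB _).mpr ⟨b, b.2, rfl⟩, ?_⟩
    have := congrArg (algebraMap M K) hab
    rw [map_div₀] at this
    exact this.symm
  · -- regular at the centre: `A ≅ B` carries centre to centre
    have hmapS : A.toSubring.map (algebraMap M K) = B.toSubring := by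
      ext z
      simp only [Subring.mem_map, Subalgebra.mem_toSubring, hmemB]
      constructor
      · rintro ⟨a, ha, rfl⟩
        exact ⟨a, ha, rfl⟩
      · rintro ⟨a, ha, rfl⟩
        exact ⟨a, ha, rfl⟩
    let e : A.toSubring ≃+* B.toSubring :=
      (A.toSubring.equivMapOfInjective (algebraMap M K) (algebraMap M K).injective).trans
        (RingEquiv.subringCongr hmapS)
    have he : ∀ a : A.toSubring, ((e a : B.toSubring) : K) = algebraMap M K a := fun _ => rfl
    set P : Ideal B.toSubring := Ideal.comap (Subring.inclusion hBO) (maximalIdeal O) with hP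
    haveI hPp : P.IsPrime := Ideal.comap_isPrime _ _
    have hPe : P.comap (e : A.toSubring →+* B.toSubring) =
        Ideal.comap (Subring.inclusion h) (maximalIdeal (O.comap (algebraMap M K))) := by
      ext a
      have h2 : Subring.inclusion hBO (e a) = ⟨algebraMap M K a, hBO (e a).2⟩ :=
        Subtype.ext (he a)
      simp only [Ideal.mem_comap, hP, RingHom.coe_coe]
      rw [h2]
      exact (Literature.AlgebraicGeometry.Resolution.mk_mem_maximalIdeal_comap_iff O
        (algebraMap M K) (h a.2)).symm
    haveI : (P.comap (e : A.toSubring →+* B.toSubring)).IsPrime := Ideal.comap_isPrime _ _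
    exact (Literature.AlgebraicGeometry.Resolution.isRegularLocalRing_localization_iff_of_ringEquiv
      e P).mpr (isRegularLocalRing_localization_atPrime_congr hPe.symm hreg)

/-- **K8 · THE DENSE LAW (relative local uniformization ascends separable dense extensions).**
Characteristic-free and base-free: if `F₀` is a finitely generated intermediate field of `K/k` such that
the valued subfield `(F₀, O ∩ F₀)` admits relative local uniformization over `k`, `K | F₀` is separably
generated and `K` is dense over `F₀` for `O`, then `(K, O)` admits relative local uniformization over `k`.
Proof: (hB) by `regularBase_of_relLU`; (hF) every finite `Z ⊆ O` is smoothly `O ∩ F₀`-uniformizable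
by Knaf–Kuhlmann 2009 Prop. 3.11 over `O_{F₀}` (tree `stub_stronglySmoothTopOverAbhyankarSubfield` —
its statement carries no Abhyankar hypothesis); Prop. 3.5 / Cor. 3.6 with a regular base
(tree `stub_relLU_of_regularBase`) concludes. [KnafKuhlmann2009, Prop. 3.11, Prop. 3.5, Cor. 3.6] [folklore] -/
theorem relLU_of_sepDense (O : ValuationSubring K) (F₀ : IntermediateField k K) (hF₀fg : F₀.FG)
    (hLU : RelLocalUniformization k F₀ (O.comap (algebraMap F₀ K)))
    (hsep : SeparablyGeneratedOver F₀.toSubfield (⊤ : Subfield K)) (hdense : IsDenseOver O F₀) :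
    RelLocalUniformization k K O := by
  classical
  intro R hR hfrac hRO
  have hk : ∀ c : k, algebraMap k K c ∈ O := algebraMap_mem_of_le O R hRO
  haveI := hfrac
  have htopfg : (⊤ : IntermediateField k K).FG := PfaffLine.intermediateField_top_fg_of_isFractionRing R hR
  have hkF₀ : (algebraMap k K).fieldRange ≤ F₀.toSubfield := by
    intro x hx
    obtain ⟨c, rfl⟩ := RingHom.mem_fieldRange.mp hx
    exact (IntermediateField.mem_toSubfield _ _).mpr (F₀.algebraMap_mem c)
  have hB := regularBase_of_relLU O hk F₀ hF₀fg hLU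
  have hdense' : ∀ x w : K, w ≠ 0 → ∃ a ∈ F₀.toSubfield, O.valuation (x - a) < O.valuation w := by
    intro x w hw
    obtain ⟨a, ha, hlt⟩ := hdense x w hw
    exact ⟨a, (IntermediateField.mem_toSubfield _ _).mpr ha, hlt⟩
  have hF := stub_stronglySmoothTopOverAbhyankarSubfield k K O htopfg F₀.toSubfield hkF₀ hsep hdense'
  obtain ⟨A, h, hRA, hAfg, -, hreg⟩ :=
    stub_relLU_of_regularBase k K O hk F₀.toSubfield hkF₀ hB hF R hR hRO
  exact ⟨A, h, hRA, hAfg, hreg⟩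

end Dense

end Summit.ResolutionOfSingularities.ResolutionOfSingularities.Theorems.ToricLadder
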